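import Summits.ResolutionOfSingularities.ResolutionOfSingularities.Theorems.TightDefectStrongWalks
import Literature.Barriers.ResolutionOfSingularities.ResidualOrderUnboundedNarrow
import Literature.AlgebraicGeometry.Resolution.OrdZeroBasics
import Summits.ResolutionOfSingularities.ResolutionOfSingularities.Theorems.FrobeniusDescentAlgebra
import HarnessLib

/-!
# FrobeniusDescentStates — §2 of the node `FrobeniusDescent` (decomp-res lens-5 g12)

Over a field of characteristic `p`: orders and `p`-th powers (the tree's `ordZero_pow`; `pow_char_injective`), the top ideal and
ISOLATION under Frobenius (`topIdeal_pow_char`, `isolatedTop_pow_char_iff`), the FROBENIUS OF A STATE `frobState` of the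
tree's forced-walk model (`Theorems.TightDefectClasses`) with `step_frobState` (the entire forced step commutes with it),
shades `× p`, equimultiplicity and roots transported, the LIFT / DESCENT of infinite forced walks (`liftWalk`,
`descendWalk`), and PRIMITIVE residual polynomials (`Primitive`; over a perfect field an imprimitive one is a `p`-th power).
All PROVED, 0 `sorry`.  See `Theorems.FrobeniusDescentAlgebra` for the node's blocker-first docstring.
-/

noncomputable section

open MvPolynomial
open Literature.AlgebraicGeometry.Resolution
open Literature.AlgebraicGeometry.Resolution.Hauser2010
open Literature.AlgebraicGeometry.Resolution.PointBlowup
open Literature.Barriers.ResolutionOfSingularities.HauserPerlega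
open Summit.ResolutionOfSingularities.ResolutionOfSingularities.Theorems.TightDefectClasses
open Summit.ResolutionOfSingularities.ResolutionOfSingularities.Theorems.TightDefectStrongWalks

open Summit.ResolutionOfSingularities.ResolutionOfSingularities.Theorems.FrobeniusDescentAlgebra

namespace Summit.ResolutionOfSingularities.ResolutionOfSingularities.Theorems.FrobeniusDescentStates

/-! ## §2 Over a field: orders, isolation, equimultiplicity, roots and the STEP under Frobenius -/

section FieldAlgebra

variable {σ : Type} [DecidableEq σ] {K : Type} [Field K] (p : ℕ) [hp : Fact p.Prime] [CharP K p]

omit [DecidableEq σ] in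
/-- `H ↦ H^p` is injective on `K[y]` (reduced). [folklore] -/
theorem pow_char_injective : Function.Injective (fun H : MvPolynomial σ K => H ^ p) :=
  fun _ _ h => frobenius_inj (MvPolynomial σ K) p (by simpa only [frobenius_def] using h)

omit [DecidableEq σ] in
/-- **The top-locus ideal of `F^p` at exponent `pq` is the Frobenius image of that of `F` at exponent `q`**:
`J_{pq}(F^p) = Frob(J_q(F)) · K[y]`. [folklore] -/
theorem topIdeal_pow_char (q : ℕ) (F : MvPolynomial σ K) :
    topIdeal (p * q) (F ^ p) = (topIdeal q F).map (frobenius (MvPolynomial σ K) p) := by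
  unfold topIdeal
  rw [Ideal.map_span]
  apply le_antisymm
  · refine Ideal.span_le.mpr ?_
    rintro _ ⟨e, ⟨he0, heq⟩, rfl⟩
    by_cases hP : IsPthPowerExponent p e
    · obtain ⟨d, rfl⟩ := exists_eq_smul_of_forall_dvd ((isPthPowerExponent_iff _ _).mp hP)
      apply Ideal.subset_span
      refine ⟨hasseDeriv K d F, ⟨d, ⟨fun h0 => he0 (by rw [h0, smul_zero]), ?_⟩, rfl⟩, ?_⟩
      · rw [degree_smul_exp] at heq
        exact Nat.lt_of_mul_lt_mul_left heq
      · rw [frobenius_def]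
        exact (hasseDeriv_smul_pow_char p d F).symm
    · obtain ⟨i, hi⟩ := exists_not_dvd_of_not_isPthPowerExponent p hP
      beta_reduce
      rw [SetLike.mem_coe, hasseDeriv_pow_char_of_not_dvd p hi]
      exact Ideal.zero_mem _
  · refine Ideal.span_le.mpr ?_
    rintro _ ⟨_, ⟨d, ⟨hd0, hdq⟩, rfl⟩, rfl⟩
    apply Ideal.subset_span
    refine ⟨p • d, ⟨smul_exp_ne_zero p hd0, ?_⟩, ?_⟩
    · show (p • d).degree < p * q
      rw [degree_smul_exp]
      exact (Nat.mul_lt_mul_left hp.out.pos).mpr hdq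
    · rw [frobenius_def]
      exact hasseDeriv_smul_pow_char p d F

omit [DecidableEq σ] in
/-- **The origin is an isolated top point of `F^p` at exponent `pq` iff it is one of `F` at exponent `q`.** [folklore] -/
theorem isolatedTop_pow_char_iff (q : ℕ) (F : MvPolynomial σ K) : IsolatedTop (p * q) (F ^ p) ↔ IsolatedTop q F := by
  unfold IsolatedTop
  rw [topIdeal_pow_char]
  constructor
  · rintro ⟨N, g, hg0, hg⟩
    refine ⟨N, g, hg0, fun i => ?_⟩
    refine (Ideal.map_le_iff_le_comap.mpr fun x hx => ?_) (hg i)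
    rw [Ideal.mem_comap, frobenius_def]
    exact Ideal.pow_mem_of_mem _ hx p hp.out.pos
  · rintro ⟨N, g, hg0, hg⟩
    refine ⟨N * p, g ^ p, ?_, fun i => ?_⟩
    · rw [map_pow]
      exact pow_ne_zero _ hg0
    · have h := Ideal.mem_map_of_mem (frobenius (MvPolynomial σ K) p) (hg i)
      rwa [frobenius_def, mul_pow, ← pow_mul] at h

/-! ### The Frobenius of a state -/

omit [DecidableEq σ] hp [CharP K p] in
/-- Two states with the same components are equal. [folklore] -/
theorem state_eq {s t : State σ K} (hF : s.F = t.F) (hr : s.r = t.r) : s = t := by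
  cases s; cases t
  simp only at hF hr
  subst hF; subst hr; rfl

/-- **The Frobenius of a state**: `(F, r) ↦ (F^p, p r)` — the state of `x^{pq} + F(y)^p` with boundary `y^{p r}`.
DEFINITION (the node's new typed object). [folklore] -/
def frobState (p : ℕ) (s : State σ K) : State σ K :=
  ⟨s.F ^ p, p • s.r⟩

omit [DecidableEq σ] hp [CharP K p] in
/-- Components of the Frobenius of a state. [folklore] -/
@[simp] theorem frobState_F (s : State σ K) : (frobState p s).F = s.F ^ p := rfl

omit [DecidableEq σ] hp [CharP K p] in
/-- Components of the Frobenius of a state. [folklore] -/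
@[simp] theorem frobState_r (s : State σ K) : (frobState p s).r = p • s.r := rfl

omit [DecidableEq σ] in
/-- `(p : ℕ∞) · x − p c = p (x − c)` in `ℕ∞`. [folklore] -/
theorem natCast_mul_tsub (x : ℕ∞) (c : ℕ) : (p : ℕ∞) * x - (p : ℕ∞) * (c : ℕ∞) = p * (x - c) := by
  have h0 : (p : ℕ∞) ≠ 0 := by exact_mod_cast hp.out.ne_zero
  induction x using ENat.recTopCoe with
  | top => rw [ENat.mul_top h0, ← Nat.cast_mul, ENat.top_sub_coe, ENat.top_sub_coe, ENat.mul_top h0]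
  | coe n =>
    norm_cast
    exact (mul_tsub p n c).symm

omit [DecidableEq σ] [CharP K p] in
/-- **The shade is multiplied by `p`**: `shade (F^p, p r) = p · shade (F, r)`. [folklore] -/
theorem shade_frobState (s : State σ K) : (frobState p s).shade = p * s.shade := by
  simp only [State.shade, frobState_F, frobState_r, ordZero_pow, degree_smul_exp, Nat.cast_mul]
  exact natCast_mul_tsub p _ _

omit [DecidableEq σ] in
/-- `1 ≤ p x ⟺ 1 ≤ x` in `ℕ∞`. [folklore] -/
theorem one_le_mul_iff (x : ℕ∞) : 1 ≤ (p : ℕ∞) * x ↔ 1 ≤ x := by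
  rw [Order.one_le_iff_ne_zero, Order.one_le_iff_ne_zero, mul_ne_zero_iff]
  exact and_iff_right (by exact_mod_cast hp.out.ne_zero)

omit [DecidableEq σ] [CharP K p] in
/-- Positive tight defect is Frobenius-invariant: `1 ≤ shade (F^p, p r) ⟺ 1 ≤ shade (F, r)`. [folklore] -/
theorem one_le_shade_frobState_iff (s : State σ K) : 1 ≤ (frobState p s).shade ↔ 1 ≤ s.shade := by
  rw [shade_frobState, one_le_mul_iff]

/-- **The point transform commutes with Frobenius** (same chart, SAME point `b`): `(G^p)(y + b) = G(y + b)^p`.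
[folklore] -/
theorem pointTransform_frobState (q : ℕ) (j : σ) (b : σ → K) (s : State σ K) :
    pointTransform (p * q) j b (frobState p s) = pointTransform q j b s ^ p := by
  unfold pointTransform
  rw [frobState_F, chartTransform_pow_char, translate_pow]

/-- **Equimultiplicity is Frobenius-invariant** (same chart, same point). [folklore] -/
theorem isEquimultiplePoint_frobState_iff (q : ℕ) (j : σ) (b : σ → K) (s : State σ K) :
    IsEquimultiplePoint (p * q) j b (frobState p s) ↔ IsEquimultiplePoint q j b s := by
  unfold IsEquimultiplePoint
  rw [pointTransform_frobState]
  constructor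
  · intro h d hd hdq
    have h' := h (p • d) (smul_exp_ne_zero p hd)
      (by rw [degree_smul_exp]; exact (Nat.mul_lt_mul_left hp.out.pos).mpr hdq)
    rw [Literature.Barriers.ResolutionOfSingularities.coeff_smul_pow_char K p] at h'
    exact (pow_eq_zero_iff hp.out.ne_zero).mp h'
  · intro h e he heq
    by_cases hP : IsPthPowerExponent p e
    · obtain ⟨d, rfl⟩ := exists_eq_smul_of_forall_dvd ((isPthPowerExponent_iff _ _).mp hP)
      rw [degree_smul_exp] at heq
      rw [Literature.Barriers.ResolutionOfSingularities.coeff_smul_pow_char K p,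
        h d (fun h0 => he (by rw [h0, smul_zero])) (Nat.lt_of_mul_lt_mul_left heq), zero_pow hp.out.ne_zero]
    · obtain ⟨i, hi⟩ := exists_not_dvd_of_not_isPthPowerExponent p hP
      exact coeff_pow_char_of_not_dvd p _ hi

omit [DecidableEq σ] hp in
/-- `(p • g).update j (p v) = p • g.update j v`. [folklore] -/
theorem update_smul (g : σ →₀ ℕ) (j : σ) (v : ℕ) : (p • g).update j (p * v) = p • g.update j v := by
  classical
  ext i
  simp only [Finsupp.coe_update, Function.update_apply, Finsupp.smul_apply, smul_eq_mul]
  split_ifs <;> rfl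

omit [CharP K p] in
/-- **The new exceptional multiplicities scale by `p`.** [folklore] -/
theorem newMult_frobState [DecidableEq K] (q : ℕ) (j : σ) (b : σ → K) (s : State σ K) :
    newMult (p * q) j b (frobState p s) = p • newMult q j b s := by
  unfold newMult
  rw [frobState_F, frobState_r, Finsupp.filter_smul, ordZero_pow, toNat_natCast_mul p _ hp.out.ne_zero,
    ← mul_tsub, update_smul]

/-- **THE STEP COMMUTES WITH FROBENIUS** (same chart `j`, same point `b`): `step_{pq}(F^p, p r) = Frob(step_q(F, r))`
— chart transform, translation, cleaning and the multiplicity law all commute with `(·)^p`. [folklore] -/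
theorem step_frobState [DecidableEq K] (q : ℕ) (j : σ) (b : σ → K) (s : State σ K) :
    step (p * q) j b (frobState p s) = frobState p (step q j b s) := by
  refine state_eq ?_ ?_
  · show deletePthPowers (p * q) (pointTransform (p * q) j b (frobState p s))
      = (deletePthPowers q (pointTransform q j b s)) ^ p
    rw [pointTransform_frobState, deletePthPowers_pow_char]
  · show newMult (p * q) j b (frobState p s) = p • newMult q j b s
    exact newMult_frobState p q j b s

omit [DecidableEq σ] in
/-- `(p q : ℕ∞) ≤ p x ⟺ q ≤ x`. [folklore] -/
theorem natCast_mul_le_mul_iff (q : ℕ) (x : ℕ∞) : ((p * q : ℕ) : ℕ∞) ≤ p * x ↔ ((q : ℕ) : ℕ∞) ≤ x := by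
  have h0 : (p : ℕ∞) ≠ 0 := by exact_mod_cast hp.out.ne_zero
  induction x using ENat.recTopCoe with
  | top =>
    rw [ENat.mul_top h0]
    exact ⟨fun _ => le_top, fun _ => le_top⟩
  | coe n =>
    norm_cast
    exact ⟨fun h => Nat.le_of_mul_le_mul_left h hp.out.pos, fun h => Nat.mul_le_mul_left p h⟩

/-- **Roots correspond**: `(F^p, p r)` is a `pq`-root iff `(F, r)` is a `q`-root. [folklore] -/
theorem isRoot_frobState_iff (q : ℕ) (s : State σ K) : IsRoot (p * q) (frobState p s) ↔ IsRoot q s := by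
  unfold IsRoot
  rw [frobState_F, frobState_r, deletePthPowers_pow_char, ordZero_pow, natCast_mul_le_mul_iff]
  refine and_congr ⟨fun h => smul_exp_injective p (by simp only [h, smul_zero]), fun h => by rw [h, smul_zero]⟩
    (and_congr ⟨fun h => pow_char_injective p h, fun h => by rw [h]⟩ Iff.rfl)

/-! ### Transport of forced walks -/

/-- The states of the DESCENDED walk: same charts, same points, exponent `q`, from `s`. DEFINITION (support). [folklore] -/
def descSt [DecidableEq K] (q : ℕ) (s : State σ K) (j : ℕ → σ) (b : ℕ → σ → K) : ℕ → State σ K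
  | 0 => s
  | i + 1 => step q (j i) (b i) (descSt q s j b i)

/-- Along a walk from `Frob s`, every state is the Frobenius of the descended state. [folklore] -/
theorem st_eq_frobState_descSt [DecidableEq K] {q : ℕ} {s : State σ K} (W : ForcedWalk (p * q) (frobState p s))
    (i : ℕ) : W.st i = frobState p (descSt q s W.j W.b i) := by
  induction i with
  | zero => exact W.st_zero
  | succ i ih => rw [W.st_succ, ih, step_frobState]; rfl

/-- **DESCENT**: an infinite forced walk at exponent `pq` from `(F^p, p r)` descends to an infinite forced walk at
exponent `q` from `(F, r)` with the SAME charts and points (equimultiplicity and isolation are Frobenius-invariant).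
DEFINITION (the node's engine, decided). [folklore] -/
def descendWalk [DecidableEq K] {q : ℕ} {s : State σ K} (W : ForcedWalk (p * q) (frobState p s)) : ForcedWalk q s where
  j := W.j
  b := W.b
  st := descSt q s W.j W.b
  st_zero := rfl
  st_succ := fun _ => rfl
  onExc := W.onExc
  equimult i := (isEquimultiplePoint_frobState_iff p q (W.j i) (W.b i) _).mp
    (st_eq_frobState_descSt p W i ▸ W.equimult i)
  isolated i := (isolatedTop_pow_char_iff p q _).mp (by
    have h := W.isolated i
    rw [st_eq_frobState_descSt p W i] at h
    exact h)

/-- **LIFT**: an infinite forced walk at exponent `q` from `(F, r)` lifts to one at exponent `pq` from `(F^p, p r)`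
(the Hauser–Perlega twist `expand`, here as `(·)^p` so that the points need no `p`-th roots). DEFINITION (engine).
[folklore] -/
def liftWalk [DecidableEq K] {q : ℕ} {s : State σ K} (W : ForcedWalk q s) : ForcedWalk (p * q) (frobState p s) where
  j := W.j
  b := W.b
  st i := frobState p (W.st i)
  st_zero := by
    show frobState p (W.st 0) = frobState p s
    rw [W.st_zero]
  st_succ i := by
    show frobState p (W.st (i + 1)) = step (p * q) (W.j i) (W.b i) (frobState p (W.st i))
    rw [W.st_succ, step_frobState]
  onExc := W.onExc
  equimult i := (isEquimultiplePoint_frobState_iff p q _ _ _).mpr (W.equimult i)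
  isolated i := (isolatedTop_pow_char_iff p q _).mpr (W.isolated i)

/-- Shades along the descended walk are the shades of the walk divided by `p`. [folklore] -/
theorem shade_st_eq_descend [DecidableEq K] {q : ℕ} {s : State σ K} (W : ForcedWalk (p * q) (frobState p s)) (i : ℕ) :
    (W.st i).shade = p * ((descendWalk p W).st i).shade := by
  have h := shade_frobState p (descSt q s W.j W.b i)
  rw [← st_eq_frobState_descSt p W i] at h
  exact h

/-- Shades along the lifted walk are `p` times the shades. [folklore] -/
theorem shade_st_liftWalk [DecidableEq K] {q : ℕ} {s : State σ K} (W : ForcedWalk q s) (i : ℕ) :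
    ((liftWalk p W).st i).shade = p * (W.st i).shade :=
  shade_frobState p (W.st i)

/-! ### Primitive residual polynomials -/

omit [DecidableEq σ] in
/-- `F` is **PRIMITIVE** (for `p`): some monomial of `F` has an exponent NOT divisible by `p`, i.e. `F ∉
K[y₁ᵖ, …, yₙᵖ]`,
i.e. some first partial derivative of `F` is non-zero.  DEFINITION (the carve's predicate; decidable on coefficients).
[folklore] -/
def Primitive (p : ℕ) (F : MvPolynomial σ K) : Prop :=
  ∃ d ∈ F.support, ∃ i, ¬ p ∣ d i

omit [DecidableEq σ] in
/-- **Over a perfect field an imprimitive polynomial is a `p`-th power** (take `p`-th roots of the coefficients).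
[folklore] -/
theorem exists_eq_pow_of_not_primitive [PerfectRing K p] {F : MvPolynomial σ K} (h : ¬ Primitive p F) :
    ∃ G : MvPolynomial σ K, F = G ^ p := by
  have hdiv : ∀ d ∈ F.support, ∀ i, p ∣ d i := fun d hd i => by
    by_contra hi
    exact h ⟨d, hd, i, hi⟩
  refine ⟨∑ d ∈ F.support, monomial (divExp p d) ((frobeniusEquiv K p).symm (coeff d F)), ?_⟩
  rw [sum_pow_char p]
  conv_lhs => rw [F.as_sum]
  refine Finset.sum_congr rfl fun d hd => ?_
  rw [monomial_pow, smul_divExp p (hdiv d hd), frobeniusEquiv_symm_pow_p]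

omit [DecidableEq σ] in
/-- A `p`-th power is imprimitive. [folklore] -/
theorem not_primitive_pow (G : MvPolynomial σ K) : ¬ Primitive p (G ^ p) := by
  rintro ⟨e, he, i, hi⟩
  exact mem_support_iff.mp he (coeff_pow_char_of_not_dvd p G hi)

omit hp [CharP K p] in
/-- A polynomial cleaned of `p`-th powers (exponent `q = p`, `e = 1`) is primitive or zero. [folklore] -/
theorem primitive_of_clean_one {F : MvPolynomial σ K} (hF : deletePthPowers p F = F) (hF0 : F ≠ 0) : Primitive p F := by
  obtain ⟨d, hd⟩ := MvPolynomial.ne_zero_iff.mp hF0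
  have hd' := hd
  rw [← hF, coeff_deletePthPowers] at hd'
  by_cases hP : IsPthPowerExponent p d
  · exact (hd' (if_pos hP)).elim
  · obtain ⟨i, hi⟩ := exists_not_dvd_of_not_isPthPowerExponent p hP
    exact ⟨d, mem_support_iff.mpr hd, i, hi⟩

end FieldAlgebra

end Summit.ResolutionOfSingularities.ResolutionOfSingularities.Theorems.FrobeniusDescentStates
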